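/-
Copyright: statement-level skeleton of a published paper (lit-balaban cell, Phase-2 proof seat p25, gen 18). No proof
claims beyond what the kernel checks below.
-/
import Literature.MathematicalPhysics.QuantumFieldTheory.BalabanImbrieJaffe1984to88.BIJ88WalkWeights312

/-!
# `BalabanImbrieJaffe1984to88.BIJ88WalkTermCount312` — T. Bałaban, J. Imbrie, A. Jaffe, *Effective action and cluster
properties of the abelian Higgs model*, Commun. Math. Phys. **114** (1988) 257–315 [BalabanImbrieJaffe1988], §5.14
p. 310–312 [PDF 54–56], verbatim: *"We give random walk expansions for the propagators … The leading terms … we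
transform further. The others, localized in region X, have a factor of e^{−cr(e_k)|X|}"*, *"After sufficiently many
integrations by parts, all components of X will be complete"*, *"It is now a standard exercise to estimate the
expansion"* — **SUMMING OVER THE TERMS OF THE EXPANSION WITH THE COVARIANCE SPLIT, THE RANDOM-WALK PIECES WEIGHTED**
(p25 gen 18).  The number of pieces `|P|` (the terms of the random-walk expansion) must never be COUNTED — they are
SUMMED with weights `ρ p ≥ 0` (e.g. `ρ p = B p · e^{a·#reg p}`, finite by the convergence of the random-walk expansion):
along a run, `Σ_{o} (Π_{p ∈ o.dp} ρ p) · W^{rpot o} ≤ W^{rpot g}` as soon as `(Σ_p ρ p) · (#alternatives) ≤ W`, `W ≥ 1`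
(`run_wsum_le`, the weighted form of gen 17's `run_wcount_le`); along the expansion the potential telescopes and
`Σ_{t ∈ expand done rest} Π_{X ∈ blocks ∪ remainder components} Π_{p ∈ X.pcs} ρ p ≤ W^{Φ(done,rest)} · Π_{h ∈ done} Π_{p ∈ h.pcs} ρ p`
(`expand_wsum_le`); combined with the weight invariant of `BIJ88WalkWeights312`: the ℓ¹ NORM OF THE WHOLE EXPANSION
`Σ_t |coef_t|·Π‖dirs_t‖·e^{a·Σ_{walk pieces of t} #reg} ≤ ((Σ_p B p e^{a #reg p})·(Φ₀ + Σ_m|legs m|))^{Φ₀(K)}` for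
couplings `|c m| ≤ 1` (`expand_l1_le`).

statement-level skeleton of published theorems with citation tags; proofs where landed; nothing here is a claim
about the Yang–Mills mass gap

PDF held: `paper:balaban1988-cmp114-bij-abelian-higgs-effective-action` (journal page = PDF page + 256); p. 310–312 =
PDF 54–56 (`p0054.txt` L24–31, `p0055.txt` L23–38, `p0056.txt` L1–25 re-read this session, 2026-08-22).

CITATION HEADER (lean-in-tree rule).  lit-balaban cell (HOME `run/shared/lean/pub/lit-balaban/`), Phase 2, seat p25
gen 18; row **C2.Claim@312** of `HOME/lit-balaban-r16/ROWS-C2-part2.md` (owner r16, referee ref-5; head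
`BIJ88Sect5StatementsPart4.Ineq312` untouched).  USED BY NAME, nothing restated: `BIJ88WalkRun311.{run, rpot, pristine,
WGrp, WOut, rpot_*}`, `BIJ88WalkRunEnv311.{run_rest_subset, run_done_le, run_pcs_eq}`, `BIJ88WalkExpansion311.{expand,
WTerm, oact}`, `BIJ88WalkWeights312.{wt, tsize, run_weight, expand_weight}` (this seat and generation),
`BIJ88LabelledRun311.{sum_map_bind, sum_map_fbind, sum_map_mbind, mbind}` (p25 gen 16), `BIJ88VertexComponents311.maxArity`.

## What is proved (0 `sorry`, standard axioms, no new `Prop` facts; definitions with bodies: `pot`, `pw`)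

* §1 **`run_wsum_le`** (the weighted count along a run), `run_rpot_le` (the potential only decreases).
* §2 `pot` (the potential `Φ(done,rest) = Σ_{h∈done}|pend h| + Σ_{j∈rest}(|obs j|+1+M·maxArity)`), `rpot_pristine_le_pot`,
  `expand_pot_key` (telescoping), `pw` (the piece weight of a component `Π_{p∈pcs} ρ p`), **`expand_wsum_le`**,
  `expand_wsum_init_le`.
* §3 **`expand_l1_le`**: the ℓ¹ norm of the integration by parts of a product of observables with the random-walk
  regions exponentially weighted.
HONEST SCOPE: (a) the count of the alternatives per step is GLOBAL (all pending legs, all observables, all vertices: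
`W ≥ (Σρ)·(Φ₀ + Σ_m|legs m|)`) — print's locality of `C_loc` (alternatives within `O(r(e_k))`) is not used, so the
constant depends on the total number of legs `Φ₀(K)` of the FIXED finite family `K` of observables, as print's `c(F(X))`
may; (b) `ρ`, `B`, `a` are data (the convergence of the random-walk expansion `Σ_p B p e^{a #reg p} < ∞` is the
hypothesis, not derived); (c) no analytic factor; (d) contraction-graph components; (e) no `Ineq312` binder.  NOT summit
progress; NOT continuum; NOT Clay.  Imports `BIJ88WalkWeights312` only; modifies nothing.
-/

noncomputable section

namespace Literature.MathematicalPhysics.QuantumFieldTheory.BalabanImbrieJaffe1984to88.BIJ88WalkTermCount312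

open Classical Matrix Finset
open scoped BigOperators
open BIJ88VertexComponents311 (maxArity length_legs_le)
open BIJ88LabelledRun311 (fbind mbind mem_mbind sum_map_bind sum_map_fbind sum_map_mbind)
open BIJ88WalkRun311 BIJ88WalkRunEnv311 BIJ88WalkExpansion311 BIJ88WalkWeights312

variable {S : Type} [Fintype S] {ι : Type} [Fintype ι] {κ : Type} [LinearOrder κ] {P : Type} [Fintype P]

/-! ## §1  The weighted count along a run -/

section Run

variable {Cov : P → Matrix S S ℝ} {trig : P → Bool} {f : S → ℝ} {c : ι → ℝ} {legs : ι → List (S → ℝ)}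
  {obs : κ → List (S → ℝ)} {M : ℕ} {ρ : P → ℝ}

/-- **THE WEIGHTED COUNT ALONG A RUN** (the weighted form of gen 17's `run_wcount_le`): for piece weights `ρ ≥ 0`,
`W ≥ 1` and `(Σ_p ρ p)·(rpot + Σ_m|legs m|) ≤ W` — at every step the alternatives are: a piece (summed with `ρ`),
then one of at most `rpot + Σ_m|legs m|` targets —
`Σ_{o ∈ run g rest done} (Π_{p∈o.dp} ρ p)·W^{rpot o} ≤ W^{rpot g}`. [cite: BalabanImbrieJaffe1988, §5.14 p.311–312] -/
theorem run_wsum_le (hρ : ∀ p, 0 ≤ ρ p) : ∀ (n : ℕ) (g : WGrp S κ ι P) (rest : Finset κ) (done : Multiset (WGrp S κ ι P)),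
    rpot obs M (maxArity legs) g rest done < n → ∀ W : ℝ, 1 ≤ W →
      (∑ p, ρ p) * ((rpot obs M (maxArity legs) g rest done + ∑ m, (legs m).length : ℕ) : ℝ) ≤ W →
        ((run Cov trig f c legs obs M g rest done).map fun o =>
            (o.dp.map ρ).prod * W ^ rpot obs M (maxArity legs) o.g o.rest o.done).sum
          ≤ W ^ rpot obs M (maxArity legs) g rest done
  | 0, _, _, _, hn => fun _ _ _ => absurd hn (Nat.not_lt_zero _)
  | n + 1, g, rest, done, hn => by
    intro W hW1 hW
    have hn' : rpot obs M (maxArity legs) g rest done ≤ n := Nat.lt_succ_iff.1 hn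
    have hR : 1 ≤ rpot obs M (maxArity legs) g rest done := by simp only [rpot]; omega
    have hW0 : 0 ≤ W := zero_le_one.trans hW1
    set R := rpot obs M (maxArity legs) g rest done with hRdef
    have hρs : 0 ≤ ∑ p, ρ p := Finset.sum_nonneg fun p _ => hρ p
    have IH : ∀ g' rest' done', rpot obs M (maxArity legs) g' rest' done' < R →
        ((run Cov trig f c legs obs M g' rest' done').map fun o =>
            (o.dp.map ρ).prod * W ^ rpot obs M (maxArity legs) o.g o.rest o.done).sum ≤ W ^ (R - 1) :=
      fun g' rest' done' hlt => by
        have hle : rpot obs M (maxArity legs) g' rest' done' + ∑ m, (legs m).length ≤ R + ∑ m, (legs m).length := by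
          omega
        have hW' : (∑ p, ρ p) * ((rpot obs M (maxArity legs) g' rest' done' + ∑ m, (legs m).length : ℕ) : ℝ) ≤ W :=
          le_trans (mul_le_mul_of_nonneg_left (Nat.cast_le.2 hle) hρs) hW
        exact (run_wsum_le hρ n g' rest' done' (lt_of_lt_of_le hlt hn') W hW1 hW').trans
          (pow_le_pow_right₀ hW1 (by omega))
    by_cases hc : g.complete M = true
    · rw [run_of_complete Cov trig f c legs obs M hc]
      simp [hRdef]
    · obtain ⟨u, L, hp⟩ := List.exists_cons_of_ne_nil (WGrp.pend_ne_nil_of_not_complete hc)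
      have hnv : Multiset.card g.vxs < M := WGrp.nv_lt_of_not_complete hc
      rw [run_of_not_complete Cov trig f c legs obs M hc hp rest done, sum_map_bind]
      have hE0 : 0 ≤ W ^ (R - 1) := pow_nonneg hW0 _
      refine le_trans (Finset.sum_le_sum (g := fun p => ρ p * (((R + ∑ m, (legs m).length : ℕ) : ℝ) * W ^ (R - 1)))
        fun p _ => ?_) ?_
      · -- for a fixed piece `p`: every outcome of the six blocks carries the factor `ρ p`
        simp only [Multiset.map_add, Multiset.sum_add, sum_map_bind, sum_map_fbind, sum_map_mbind, Multiset.map_map,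
          Function.comp_def, WOut.scale_dp, WOut.scale_g, WOut.scale_rest, WOut.scale_done, WOut.push_dp, WOut.push_g,
          WOut.push_rest, WOut.push_done, WOut.bump_dp, WOut.bump_g, WOut.bump_rest, WOut.bump_done, Multiset.map_cons,
          Multiset.prod_cons, mul_assoc, Multiset.sum_map_mul_left, ← Finset.mul_sum, ← mul_add]
        refine mul_le_mul_of_nonneg_left ?_ (hρ p)
        -- the six blocks, each outcome family bounded by the induction hypothesis
        have h1 : ∑ i ∈ range L.length, ((run Cov trig f c legs obs M
              ⟨L.eraseIdx i, g.nchi, g.vxs, g.lab, p ::ₘ g.pcs, g.nw + (trig p).toNat⟩ rest done).map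
              fun o => (o.dp.map ρ).prod * W ^ rpot obs M (maxArity legs) o.g o.rest o.done).sum
            ≤ (L.length : ℝ) * W ^ (R - 1) :=
          (Finset.sum_le_sum fun i _ => IH _ _ _ (rpot_pair obs M _ rest done hp i _ _)).trans
            (by rw [Finset.sum_const, Finset.card_range, nsmul_eq_mul])
        have h2 : ∑ j ∈ rest.attach, ∑ i ∈ range (obs j).length, ((run Cov trig f c legs obs M
              ⟨L ++ (obs j).eraseIdx i, g.nchi, g.vxs, g.lab ∪ {j.1}, p ::ₘ g.pcs, g.nw + (trig p).toNat⟩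
              (rest.erase j) done).map
              fun o => (o.dp.map ρ).prod * W ^ rpot obs M (maxArity legs) o.g o.rest o.done).sum
            ≤ ((∑ j ∈ rest, (obs j).length : ℕ) : ℝ) * W ^ (R - 1) := by
          calc _ ≤ ∑ j ∈ rest.attach, (((obs j).length : ℕ) : ℝ) * W ^ (R - 1) :=
                Finset.sum_le_sum fun j _ => (Finset.sum_le_sum fun i _ =>
                  IH _ _ _ (rpot_pristine obs M _ rest done hp j.2 i _ _ _)).trans
                    (by rw [Finset.sum_const, Finset.card_range, nsmul_eq_mul])
            _ = ((∑ j ∈ rest, (obs j).length : ℕ) : ℝ) * W ^ (R - 1) := by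
                rw [Finset.sum_attach rest (fun j => (((obs j).length : ℕ) : ℝ) * W ^ (R - 1)), ← Finset.sum_mul,
                  Nat.cast_sum]
        have h3 : (done.attach.map fun h => ∑ i ∈ range h.1.pend.length, ((run Cov trig f c legs obs M
              (WGrp.absorb trig L g h.1 i p) rest (done.erase h.1)).map
              fun o => (o.dp.map ρ).prod * W ^ rpot obs M (maxArity legs) o.g o.rest o.done).sum).sum
            ≤ (((done.map fun h => h.pend.length).sum : ℕ) : ℝ) * W ^ (R - 1) := by
          calc _ ≤ (done.attach.map fun h => ((h.1.pend.length : ℕ) : ℝ) * W ^ (R - 1)).sum :=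
                Multiset.sum_map_le_sum_map _ _ fun h _ => (Finset.sum_le_sum fun i _ =>
                  IH _ _ _ (rpot_absorb obs M _ rest done trig hp h.2 i p)).trans
                    (by rw [Finset.sum_const, Finset.card_range, nsmul_eq_mul])
            _ = (done.map fun h => ((h.pend.length : ℕ) : ℝ) * W ^ (R - 1)).sum :=
                congrArg Multiset.sum (Multiset.attach_map_val' done (fun h => ((h.pend.length : ℕ) : ℝ) * W ^ (R - 1)))
            _ = (((done.map fun h => h.pend.length).sum : ℕ) : ℝ) * W ^ (R - 1) := by
                rw [Multiset.sum_map_mul_right, Nat.cast_multiset_sum, Multiset.map_map]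
                rfl
        have h4 : ((run Cov trig f c legs obs M ⟨L, g.nchi, g.vxs, g.lab, p ::ₘ g.pcs, g.nw + (trig p).toNat⟩
              rest done).map fun o => (o.dp.map ρ).prod * W ^ rpot obs M (maxArity legs) o.g o.rest o.done).sum
            ≤ W ^ (R - 1) := IH _ _ _ (rpot_drop obs M _ rest done hp _ _ _)
        have h5 : ((run Cov trig f c legs obs M ⟨L, g.nchi + 1, g.vxs, g.lab, p ::ₘ g.pcs, g.nw + (trig p).toNat⟩
              rest done).map fun o => (o.dp.map ρ).prod * W ^ rpot obs M (maxArity legs) o.g o.rest o.done).sum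
            ≤ W ^ (R - 1) := IH _ _ _ (rpot_drop obs M _ rest done hp _ _ _)
        have h6 : ∑ m, ∑ j ∈ range (legs m).length, ((run Cov trig f c legs obs M
              ⟨L ++ (legs m).eraseIdx j, g.nchi, m ::ₘ g.vxs, g.lab, p ::ₘ g.pcs, g.nw + (trig p).toNat⟩ rest done).map
              fun o => (o.dp.map ρ).prod * W ^ rpot obs M (maxArity legs) o.g o.rest o.done).sum
            ≤ ((∑ m, (legs m).length : ℕ) : ℝ) * W ^ (R - 1) := by
          calc _ ≤ ∑ m, (((legs m).length : ℕ) : ℝ) * W ^ (R - 1) :=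
                Finset.sum_le_sum fun m _ => (Finset.sum_le_sum fun j _ =>
                  IH _ _ _ (rpot_vertex obs M rest done legs hp hnv m j _ _)).trans
                    (by rw [Finset.sum_const, Finset.card_range, nsmul_eq_mul])
            _ = ((∑ m, (legs m).length : ℕ) : ℝ) * W ^ (R - 1) := by rw [← Finset.sum_mul, Nat.cast_sum]
        -- the number of branches is at most `R + Σ_m |legs m|`
        have e : R = L.length + 1 + 1 + (M - Multiset.card g.vxs) * maxArity legs
            + ∑ j ∈ rest, (obs j).length + (done.map fun h => h.pend.length).sum := by
          simp only [hRdef, rpot, hp, List.length_cons]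
        have hbr : (L.length + (∑ j ∈ rest, (obs j).length) + (done.map fun h => h.pend.length).sum + 1 + 1
            + ∑ m, (legs m).length : ℕ) ≤ R + ∑ m, (legs m).length := by omega
        have hbr' : (((L.length : ℕ) : ℝ) + ((∑ j ∈ rest, (obs j).length : ℕ) : ℝ)
            + (((done.map fun h => h.pend.length).sum : ℕ) : ℝ) + 1 + 1 + ((∑ m, (legs m).length : ℕ) : ℝ))
            ≤ ((R + ∑ m, (legs m).length : ℕ) : ℝ) := by exact_mod_cast hbr
        refine (add_le_add (add_le_add (add_le_add (add_le_add (add_le_add h1 h2) h3) h4) h5) h6).trans ?_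
        calc _ = (((L.length : ℕ) : ℝ) + ((∑ j ∈ rest, (obs j).length : ℕ) : ℝ)
              + (((done.map fun h => h.pend.length).sum : ℕ) : ℝ) + 1 + 1 + ((∑ m, (legs m).length : ℕ) : ℝ))
              * W ^ (R - 1) := by ring
          _ ≤ ((R + ∑ m, (legs m).length : ℕ) : ℝ) * W ^ (R - 1) := mul_le_mul_of_nonneg_right hbr' hE0
      -- sum over the pieces
      · calc ∑ p, ρ p * (((R + ∑ m, (legs m).length : ℕ) : ℝ) * W ^ (R - 1))
            = ((∑ p, ρ p) * ((R + ∑ m, (legs m).length : ℕ) : ℝ)) * W ^ (R - 1) := by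
              rw [Finset.sum_mul, Finset.sum_mul]; simp only [mul_assoc]
          _ ≤ W * W ^ (R - 1) := mul_le_mul_of_nonneg_right hW (pow_nonneg hW0 _)
          _ = W ^ R := by rw [← pow_succ', Nat.sub_add_cancel hR]

/-- **The potential only decreases along a run** (bookkeeping for the telescoping). [cite: BalabanImbrieJaffe1988, §5.14 p.311] -/
theorem run_rpot_le (g : WGrp S κ ι P) (rest : Finset κ) (done : Multiset (WGrp S κ ι P)) :
    ∀ o ∈ run Cov trig f c legs obs M g rest done,
      rpot obs M (maxArity legs) o.g o.rest o.done ≤ rpot obs M (maxArity legs) g rest done := by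
  refine run_ind' (Q := fun g rest done o => rpot obs M (maxArity legs) o.g o.rest o.done
      ≤ rpot obs M (maxArity legs) g rest done) (fun _ _ _ _ => le_rfl) ?_ ?_ ?_ ?_ ?_ ?_ g rest done
  · intro g rest done u L p _ hp i o _ h
    simp only [WOut.scale_g, WOut.scale_rest, WOut.scale_done] at h ⊢
    exact h.trans (rpot_pair obs M _ rest done hp i _ _).le
  · intro g rest done u L p _ hp j hj i o _ h
    simp only [WOut.scale_g, WOut.scale_rest, WOut.scale_done] at h ⊢
    exact h.trans (rpot_pristine obs M _ rest done hp hj i _ _ _).le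
  · intro g rest done u L p _ hp h hh i _ o _ h'
    simp only [WOut.scale_g, WOut.scale_rest, WOut.scale_done] at h' ⊢
    exact h'.trans (rpot_absorb obs M _ rest done trig hp hh i p).le
  · intro g rest done u L p _ hp o _ h
    simp only [WOut.scale_g, WOut.scale_rest, WOut.scale_done] at h ⊢
    exact h.trans (rpot_drop obs M _ rest done hp _ _ _).le
  · intro g rest done u L p _ hp o _ h
    simp only [WOut.push_g, WOut.push_rest, WOut.push_done] at h ⊢
    exact h.trans (rpot_drop obs M _ rest done hp _ _ _).le
  · intro g rest done u L p hc hp m j o _ h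
    simp only [WOut.bump_g, WOut.bump_rest, WOut.bump_done, WOut.scale_g, WOut.scale_rest, WOut.scale_done] at h ⊢
    exact h.trans (rpot_vertex obs M rest done legs hp (WGrp.nv_lt_of_not_complete hc) m j _ _).le

end Run

/-! ## §2  The weighted count along the expansion -/

section Expand

variable {Cov : P → Matrix S S ℝ} {trig : P → Bool} {f : S → ℝ} {c : ι → ℝ} {legs : ι → List (S → ℝ)}
  {obs : κ → List (S → ℝ)} {M : ℕ} {ρ : P → ℝ}

/-- **The potential of a state of the expansion**: `Φ(done,rest) = Σ_{h∈done}|pend h| + Σ_{j∈rest}(|obs j| + 1 + M·A)`.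
[cite: BalabanImbrieJaffe1988, §5.14 p.311] -/
def pot (obs : κ → List (S → ℝ)) (M A : ℕ) (done : Multiset (WGrp S κ ι P)) (rest : Finset κ) : ℕ :=
  (done.map fun h => h.pend.length).sum + ∑ j ∈ rest, ((obs j).length + 1 + M * A)

/-- **The piece weight of a component**: `Π_{p ∈ X.pcs} ρ p`. [cite: BalabanImbrieJaffe1988, §5.14 p.311] -/
def pw (ρ : P → ℝ) (g : WGrp S κ ι P) : ℝ := (g.pcs.map ρ).prod

omit [Fintype S] [Fintype ι] [LinearOrder κ] [Fintype P] in
/-- Splitting the observable part of the potential (bookkeeping). [folklore] -/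
private theorem sum_obs_split (obs : κ → List (S → ℝ)) (M Am : ℕ) (s : Finset κ) :
    ∑ j ∈ s, ((obs j).length + 1 + M * Am) = ∑ j ∈ s, (obs j).length + ∑ _j ∈ s, (1 + M * Am) := by
  rw [← Finset.sum_add_distrib]
  exact Finset.sum_congr rfl fun _ _ => add_assoc _ _ _

omit [Fintype S] [Fintype P] in
/-- **The run of the least observable starts below the potential of the state.** [cite: BalabanImbrieJaffe1988, §5.14 p.311] -/
theorem rpot_pristine_le_pot {rest : Finset κ} (h : rest.Nonempty) (done : Multiset (WGrp S κ ι P)) :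
    rpot obs M (maxArity legs) (pristine (P := P) obs (rest.min' h)) (rest.erase (rest.min' h)) done
      ≤ pot obs M (maxArity legs) done rest := by
  have e : rpot obs M (maxArity legs) (pristine (P := P) obs (rest.min' h)) (rest.erase (rest.min' h)) done
      = (obs (rest.min' h)).length + 1 + M * maxArity legs + ∑ j ∈ rest.erase (rest.min' h), (obs j).length
        + (done.map fun h => h.pend.length).sum := by
    simp only [rpot, pristine, Multiset.card_zero, Nat.sub_zero]
  rw [e, pot, ← Finset.add_sum_erase rest (fun j => (obs j).length + 1 + M * maxArity legs) (rest.min'_mem h),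
    sum_obs_split obs M (maxArity legs) (rest.erase _)]
  omega

/-- **The telescoping inequality of the potential**: for an outcome `o` of the run of the least observable of `rest`
and any `extra ≤ |pend(o.g)|`, `rpot(start) + (extra + Φ(o.done, o.rest)) ≤ Φ(done,rest) + rpot(o)`.
[cite: BalabanImbrieJaffe1988, §5.14 p.311] -/
theorem expand_pot_key {rest : Finset κ} (h : rest.Nonempty) (done : Multiset (WGrp S κ ι P)) :
    ∀ o ∈ run Cov trig f c legs obs M (pristine obs (rest.min' h)) (rest.erase (rest.min' h)) done,
      ∀ extra, extra ≤ o.g.pend.length →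
        rpot obs M (maxArity legs) (pristine (P := P) obs (rest.min' h)) (rest.erase (rest.min' h)) done
            + (extra + pot obs M (maxArity legs) o.done o.rest)
          ≤ pot obs M (maxArity legs) done rest + rpot obs M (maxArity legs) o.g o.rest o.done := by
  intro o ho extra hx
  have hV : ∑ _j ∈ o.rest, (1 + M * maxArity legs) ≤ ∑ _j ∈ rest.erase (rest.min' h), (1 + M * maxArity legs) :=
    Finset.sum_le_sum_of_subset (run_rest_subset _ _ _ o ho)
  have e_start : rpot obs M (maxArity legs) (pristine (P := P) obs (rest.min' h)) (rest.erase (rest.min' h)) done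
      = (obs (rest.min' h)).length + 1 + M * maxArity legs + ∑ j ∈ rest.erase (rest.min' h), (obs j).length
        + (done.map fun h => h.pend.length).sum := by
    simp only [rpot, pristine, Multiset.card_zero, Nat.sub_zero]
  have e_end : rpot obs M (maxArity legs) o.g o.rest o.done = o.g.pend.length + 1
      + (M - Multiset.card o.g.vxs) * maxArity legs + ∑ j ∈ o.rest, (obs j).length
      + (o.done.map fun h => h.pend.length).sum := rfl
  rw [e_start, e_end, pot, pot,
    ← Finset.add_sum_erase rest (fun j => (obs j).length + 1 + M * maxArity legs) (rest.min'_mem h),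
    sum_obs_split obs M (maxArity legs) (rest.erase _), sum_obs_split obs M (maxArity legs) o.rest]
  omega

omit [Fintype S] [Fintype ι] [LinearOrder κ] [Fintype P] in
/-- Piece weights are nonnegative for `ρ ≥ 0` (bookkeeping). [folklore] -/
private theorem pw_nonneg (hρ : ∀ p, 0 ≤ ρ p) (g : WGrp S κ ι P) : 0 ≤ pw ρ g :=
  Multiset.prod_nonneg fun x hx => by obtain ⟨p, -, rfl⟩ := Multiset.mem_map.1 hx; exact hρ p

omit [Fintype S] [Fintype ι] [LinearOrder κ] [Fintype P] in
/-- Products of piece weights are nonnegative (bookkeeping). [folklore] -/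
private theorem prod_pw_nonneg (hρ : ∀ p, 0 ≤ ρ p) (m : Multiset (WGrp S κ ι P)) : 0 ≤ (m.map (pw ρ)).prod :=
  Multiset.prod_nonneg fun x hx => by obtain ⟨g, -, rfl⟩ := Multiset.mem_map.1 hx; exact pw_nonneg hρ g

omit [Fintype S] [Fintype ι] [LinearOrder κ] [Fintype P] in
/-- `Π_{a ∈ m} Π_{p ∈ F a} ρ p = Π_{p ∈ Σ_a F a} ρ p` (bookkeeping). [folklore] -/
private theorem prod_map_pw_eq (ρ : P → ℝ) (m : Multiset (WGrp S κ ι P)) :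
    (m.map (pw ρ)).prod = ((m.map WGrp.pcs).sum.map ρ).prod := by
  induction m using Multiset.induction_on with
  | empty => simp
  | cons g m ih => rw [Multiset.map_cons, Multiset.prod_cons, Multiset.map_cons, Multiset.sum_cons, Multiset.map_add,
      Multiset.prod_add, ih, pw]

/-- **The piece weights of an outcome's components** (from piece conservation `run_pcs_eq`): for an outcome `o` of a
run from a pristine observable, `pw(o.g) · Π_{o.done} pw = (Π_{p∈o.dp} ρ p) · Π_{done} pw`.
[cite: BalabanImbrieJaffe1988, §5.14 p.311] -/
theorem pw_outcome (ρ : P → ℝ) (j : κ) (rest : Finset κ) (done : Multiset (WGrp S κ ι P)) :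
    ∀ o ∈ run Cov trig f c legs obs M (pristine obs j) rest done,
      pw ρ o.g * (o.done.map (pw ρ)).prod = (o.dp.map ρ).prod * (done.map (pw ρ)).prod := by
  intro o ho
  have h := run_pcs_eq _ _ _ o ho
  simp only [pristine, add_zero] at h
  rw [prod_map_pw_eq, prod_map_pw_eq, pw, ← Multiset.prod_add, ← Multiset.map_add, h, Multiset.map_add,
    Multiset.prod_add]

/-- **THE WEIGHTED COUNT ALONG THE EXPANSION**: for `ρ ≥ 0`, `W ≥ 1`, `(Σ_p ρ p)·(Φ(done,rest) + Σ_m|legs m|) ≤ W`: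
`Σ_{t ∈ expand done rest} Π_{X ∈ t.consts + t.groups} pw X ≤ W^{Φ(done,rest)} · Π_{h ∈ done} pw h` — each run weighted
by `W^{rpot released}` (`run_wsum_le`), the potential telescoping (`expand_pot_key`), the piece weights conserved
(`pw_outcome`). [cite: BalabanImbrieJaffe1988, §5.14 p.311–312] -/
theorem expand_wsum_le (hρ : ∀ p, 0 ≤ ρ p) : ∀ (n : ℕ) (done : Multiset (WGrp S κ ι P)) (rest : Finset κ),
    rest.card < n → ∀ W : ℝ, 1 ≤ W →
      (∑ p, ρ p) * ((pot obs M (maxArity legs) done rest + ∑ m, (legs m).length : ℕ) : ℝ) ≤ W →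
        ((expand Cov trig f c legs obs M done rest).map fun t => ((t.consts + t.groups).map (pw ρ)).prod).sum
          ≤ W ^ pot obs M (maxArity legs) done rest * (done.map (pw ρ)).prod
  | 0, _, _, hn => fun _ _ _ => absurd hn (Nat.not_lt_zero _)
  | n + 1, done, rest, hn => by
    intro W hW1 hW
    have hW0 : 0 ≤ W := zero_le_one.trans hW1
    have hρs : 0 ≤ ∑ p, ρ p := Finset.sum_nonneg fun p _ => hρ p
    by_cases h : rest.Nonempty
    · have hi := rest.min'_mem h
      have hRs := rpot_pristine_le_pot (P := P) (legs := legs) (obs := obs) (M := M) h done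
      set Φ := pot obs M (maxArity legs) done rest with hΦ
      set R0 := rpot obs M (maxArity legs) (pristine (P := P) obs (rest.min' h)) (rest.erase (rest.min' h)) done
        with hR0
      rw [expand_of_nonempty Cov trig f c legs obs M h, mbind, Multiset.map_bind, Multiset.sum_bind]
      -- every outcome's continuation: `≤ W^{Φ − R0 + rpot o} · pw(o.g)·Π_{o.done} pw = W^{Φ−R0} · [(Π_{dp}ρ) W^{rpot o}] · Π_done pw`
      have hcont : ∀ o ∈ run Cov trig f c legs obs M (pristine obs (rest.min' h)) (rest.erase (rest.min' h)) done,
          ((if o.g.IsConst M then (expand Cov trig f c legs obs M o.done o.rest).map fun t => (oact o t).addConst o.g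
            else (expand Cov trig f c legs obs M (o.g ::ₘ o.done) o.rest).map (oact o)).map
              fun t => ((t.consts + t.groups).map (pw ρ)).prod).sum
          ≤ W ^ (Φ - R0) * (((o.dp.map ρ).prod * W ^ rpot obs M (maxArity legs) o.g o.rest o.done)
              * (done.map (pw ρ)).prod) := by
        intro o ho
        have hcard : o.rest.card < n := lt_of_lt_of_le (lt_of_le_of_lt (Finset.card_le_card (run_rest_subset _ _ _ o ho))
          (Finset.card_erase_lt_of_mem hi)) (Nat.lt_succ_iff.1 hn)
        have hpw := pw_outcome (Cov := Cov) (trig := trig) (f := f) (c := c) (M := M) ρ (rest.min' h)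
          (rest.erase (rest.min' h)) done o ho
        have hle := run_rpot_le _ _ _ o ho
        split_ifs with hg
        · have key := expand_pot_key (P := P) h done o ho 0 (Nat.zero_le _)
          rw [Multiset.map_map]
          have hb : (∑ p, ρ p) * ((pot obs M (maxArity legs) o.done o.rest + ∑ m, (legs m).length : ℕ) : ℝ) ≤ W :=
            le_trans (mul_le_mul_of_nonneg_left (by exact_mod_cast (by omega :
              pot obs M (maxArity legs) o.done o.rest + ∑ m, (legs m).length ≤ Φ + ∑ m, (legs m).length)) hρs) hW
          have IH := expand_wsum_le hρ n o.done o.rest hcard W hW1 hb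
          have e1 : ((expand Cov trig f c legs obs M o.done o.rest).map
              ((fun t : WTerm S κ ι P => ((t.consts + t.groups).map (pw ρ)).prod) ∘ fun t => (oact o t).addConst o.g))
              = (expand Cov trig f c legs obs M o.done o.rest).map
                  fun t => pw ρ o.g * ((t.consts + t.groups).map (pw ρ)).prod := by
            refine Multiset.map_congr rfl fun t _ => ?_
            simp only [Function.comp_apply, WTerm.addConst_consts, WTerm.addConst_groups, oact_consts, oact_groups,
              Multiset.cons_add, Multiset.map_cons, Multiset.prod_cons]
          rw [e1, Multiset.sum_map_mul_left]
          calc pw ρ o.g * ((expand Cov trig f c legs obs M o.done o.rest).map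
                  fun t => ((t.consts + t.groups).map (pw ρ)).prod).sum
              ≤ pw ρ o.g * (W ^ pot obs M (maxArity legs) o.done o.rest * (o.done.map (pw ρ)).prod) :=
                mul_le_mul_of_nonneg_left IH (pw_nonneg hρ _)
            _ = W ^ pot obs M (maxArity legs) o.done o.rest * (pw ρ o.g * (o.done.map (pw ρ)).prod) := by ring
            _ = W ^ pot obs M (maxArity legs) o.done o.rest * ((o.dp.map ρ).prod * (done.map (pw ρ)).prod) := by
                rw [hpw]
            _ ≤ W ^ (Φ - R0 + rpot obs M (maxArity legs) o.g o.rest o.done)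
                  * ((o.dp.map ρ).prod * (done.map (pw ρ)).prod) :=
                mul_le_mul_of_nonneg_right (pow_le_pow_right₀ hW1 (by omega))
                  (mul_nonneg (Multiset.prod_nonneg fun x hx => by
                    obtain ⟨p, -, rfl⟩ := Multiset.mem_map.1 hx; exact hρ p) (prod_pw_nonneg hρ _))
            _ = _ := by rw [pow_add]; ring
        · have key := expand_pot_key (P := P) h done o ho o.g.pend.length le_rfl
          rw [Multiset.map_map]
          have hpot : pot obs M (maxArity legs) (o.g ::ₘ o.done) o.rest
              = o.g.pend.length + pot obs M (maxArity legs) o.done o.rest := by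
            simp only [pot, Multiset.map_cons, Multiset.sum_cons, add_assoc]
          have hb : (∑ p, ρ p) * ((pot obs M (maxArity legs) (o.g ::ₘ o.done) o.rest + ∑ m, (legs m).length : ℕ) : ℝ)
              ≤ W :=
            le_trans (mul_le_mul_of_nonneg_left (by exact_mod_cast (by omega :
              pot obs M (maxArity legs) (o.g ::ₘ o.done) o.rest + ∑ m, (legs m).length ≤ Φ + ∑ m, (legs m).length))
              hρs) hW
          have IH := expand_wsum_le hρ n (o.g ::ₘ o.done) o.rest hcard W hW1 hb
          have e1 : ((expand Cov trig f c legs obs M (o.g ::ₘ o.done) o.rest).map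
              ((fun t : WTerm S κ ι P => ((t.consts + t.groups).map (pw ρ)).prod) ∘ oact o))
              = (expand Cov trig f c legs obs M (o.g ::ₘ o.done) o.rest).map
                  fun t => ((t.consts + t.groups).map (pw ρ)).prod :=
            Multiset.map_congr rfl fun t _ => by simp only [Function.comp_apply, oact_consts, oact_groups]
          rw [e1]
          calc ((expand Cov trig f c legs obs M (o.g ::ₘ o.done) o.rest).map
                  fun t => ((t.consts + t.groups).map (pw ρ)).prod).sum
              ≤ W ^ pot obs M (maxArity legs) (o.g ::ₘ o.done) o.rest * ((o.g ::ₘ o.done).map (pw ρ)).prod := IH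
            _ = W ^ pot obs M (maxArity legs) (o.g ::ₘ o.done) o.rest * ((o.dp.map ρ).prod * (done.map (pw ρ)).prod) := by
                rw [Multiset.map_cons, Multiset.prod_cons, hpw]
            _ ≤ W ^ (Φ - R0 + rpot obs M (maxArity legs) o.g o.rest o.done)
                  * ((o.dp.map ρ).prod * (done.map (pw ρ)).prod) :=
                mul_le_mul_of_nonneg_right (pow_le_pow_right₀ hW1 (by rw [hpot]; omega))
                  (mul_nonneg (Multiset.prod_nonneg fun x hx => by
                    obtain ⟨p, -, rfl⟩ := Multiset.mem_map.1 hx; exact hρ p) (prod_pw_nonneg hρ _))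
            _ = _ := by rw [pow_add]; ring
      have hrun : (∑ p, ρ p) * ((R0 + ∑ m, (legs m).length : ℕ) : ℝ) ≤ W :=
        le_trans (mul_le_mul_of_nonneg_left (by exact_mod_cast (by omega :
          R0 + ∑ m, (legs m).length ≤ Φ + ∑ m, (legs m).length)) hρs) hW
      calc _ ≤ ((run Cov trig f c legs obs M (pristine obs (rest.min' h)) (rest.erase (rest.min' h)) done).attach.map
              fun o => W ^ (Φ - R0) * (((o.1.dp.map ρ).prod * W ^ rpot obs M (maxArity legs) o.1.g o.1.rest o.1.done)
                * (done.map (pw ρ)).prod)).sum :=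
            Multiset.sum_map_le_sum_map _ _ fun o _ => hcont o.1 o.2
        _ = W ^ (Φ - R0) * (((run Cov trig f c legs obs M (pristine obs (rest.min' h)) (rest.erase (rest.min' h))
              done).map fun o => (o.dp.map ρ).prod * W ^ rpot obs M (maxArity legs) o.g o.rest o.done).sum
            * (done.map (pw ρ)).prod) := by
            rw [← Multiset.sum_map_mul_right, ← Multiset.sum_map_mul_left, ← Multiset.attach_map_val'
              (run Cov trig f c legs obs M (pristine obs (rest.min' h)) (rest.erase (rest.min' h)) done)]
        _ ≤ W ^ (Φ - R0) * (W ^ R0 * (done.map (pw ρ)).prod) :=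
            mul_le_mul_of_nonneg_left (mul_le_mul_of_nonneg_right
              (run_wsum_le hρ _ _ _ _ (Nat.lt_succ_self _) W hW1 hrun) (prod_pw_nonneg hρ _)) (pow_nonneg hW0 _)
        _ = W ^ Φ * (done.map (pw ρ)).prod := by rw [← mul_assoc, ← pow_add, Nat.sub_add_cancel hRs]
    · rw [expand_of_not_nonempty Cov trig f c legs obs M h]
      simp only [Multiset.map_singleton, Multiset.sum_singleton, zero_add]
      exact le_mul_of_one_le_left (prod_pw_nonneg hρ _) (one_le_pow₀ hW1)

/-- **THE WEIGHTED COUNT OF THE EXPANSION OF A PRODUCT OF OBSERVABLES** (nothing set aside):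
`Σ_{t ∈ expand 0 K} Π_{X ∈ t.consts + t.groups} Π_{p ∈ X.pcs} ρ p ≤ W^{Φ₀(K)}` for
`W ≥ max(1, (Σ_p ρ p)·(Φ₀(K) + Σ_m|legs m|))`. [cite: BalabanImbrieJaffe1988, §5.14 p.311–312] -/
theorem expand_wsum_init_le (hρ : ∀ p, 0 ≤ ρ p) (K : Finset κ) {W : ℝ} (hW1 : 1 ≤ W)
    (hW : (∑ p, ρ p) * ((∑ j ∈ K, ((obs j).length + 1 + M * maxArity legs) + ∑ m, (legs m).length : ℕ) : ℝ) ≤ W) :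
    ((expand Cov trig f c legs obs M 0 K).map fun t => ((t.consts + t.groups).map (pw ρ)).prod).sum
      ≤ W ^ ∑ j ∈ K, ((obs j).length + 1 + M * maxArity legs) := by
  have h := expand_wsum_le (Cov := Cov) (trig := trig) (f := f) (c := c) (legs := legs) (obs := obs) (M := M) hρ _ 0 K
    (Nat.lt_succ_self _) W hW1
  simp only [pot, Multiset.map_zero, Multiset.sum_zero, zero_add, Multiset.prod_zero, mul_one] at h
  exact h hW

end Expand

/-! ## §3  The ℓ¹ norm of the expansion, the random-walk regions exponentially weighted -/

section L1

variable {Cov : P → Matrix S S ℝ} {trig : P → Bool} {f : S → ℝ} {c : ι → ℝ} {legs : ι → List (S → ℝ)}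
  {obs : κ → List (S → ℝ)} {M : ℕ} {β : Type}

omit [Fintype P] in
/-- `Π_{p ∈ m} e^{g p} = e^{Σ_{p ∈ m} g p}` (bookkeeping). [folklore] -/
private theorem prod_map_exp (m : Multiset P) (g : P → ℝ) :
    (m.map fun p => Real.exp (g p)).prod = Real.exp ((m.map g).sum) := by
  induction m using Multiset.induction_on with
  | empty => simp
  | cons p m ih => rw [Multiset.map_cons, Multiset.prod_cons, Multiset.map_cons, Multiset.sum_cons, Real.exp_add, ih]

omit [Fintype S] [Fintype ι] [LinearOrder κ] [Fintype P] in
/-- With couplings bounded by `1`, the weight of a component with bracket bounds `B p e^{a #reg p}` is at most its piece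
weight for `ρ p = B p e^{a #reg p}` (bookkeeping). [folklore] -/
private theorem wt_le_pw {B : P → ℝ} {cV : ι → ℝ} (hB0 : ∀ p, 0 ≤ B p) (hcV0 : ∀ m, 0 ≤ cV m) (hcV1 : ∀ m, cV m ≤ 1)
    (g : WGrp S κ ι P) : wt B cV g ≤ pw B g := by
  unfold wt pw
  have h1 : (g.vxs.map cV).prod ≤ 1 := by
    have := Multiset.prod_map_le_prod_map₀ (s := g.vxs) cV (fun _ => (1 : ℝ)) (fun m _ => hcV0 m) fun m _ => hcV1 m
    rwa [Multiset.map_const', Multiset.prod_replicate, one_pow] at this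
  have h0 : 0 ≤ (g.pcs.map B).prod :=
    Multiset.prod_nonneg fun x hx => by obtain ⟨p, -, rfl⟩ := Multiset.mem_map.1 hx; exact hB0 p
  calc (g.pcs.map B).prod * (g.vxs.map cV).prod ≤ (g.pcs.map B).prod * 1 := mul_le_mul_of_nonneg_left h1 h0
    _ = _ := mul_one _

/-- **THE ℓ¹ NORM OF THE INTEGRATION BY PARTS OF A PRODUCT OF OBSERVABLES, RANDOM-WALK REGIONS EXPONENTIALLY WEIGHTED**
(p. 310 *"The others, localized in region X, have a factor of e^{−cr(e_k)|X|}"*, p. 311–312): with brackets of the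
piece `p` on the direction set bounded by `B p ≥ 0` (and `‖Cov p u‖ ≤ B p`, source brackets `≤ B p`), couplings
`|c m| ≤ cV m ≤ 1`, and the WEIGHTED number of alternatives `(Σ_p B p·e^{a·#reg p})·(Φ₀(K) + Σ_m|legs m|) ≤ W`, `W ≥ 1`:
`Σ_{t ∈ expand 0 K} |coef_t|·Π_{z∈dirs_t}‖z‖·Π_{X ∈ t.consts+t.groups} e^{a·Σ_{p ∈ X.pcs} #reg p} ≤ W^{Φ₀(K)}` — the
whole expansion is absolutely summable with every random-walk region paid `e^{a·#reg}`, uniformly in the number of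
walk terms. [cite: BalabanImbrieJaffe1988, §5.14 p.310–312] -/
theorem expand_l1_le {Dir : Set (S → ℝ)} {B : P → ℝ} {cV : ι → ℝ} {reg : P → Finset β} {a W : ℝ}
    (hB0 : ∀ p, 0 ≤ B p) (hcV0 : ∀ m, 0 ≤ cV m) (hcV1 : ∀ m, cV m ≤ 1)
    (hB : ∀ p, ∀ u ∈ Dir, ∀ w ∈ Dir, |(Cov p *ᵥ u) ⬝ᵥ w| ≤ B p) (hBf : ∀ p, ∀ u ∈ Dir, |(Cov p *ᵥ u) ⬝ᵥ f| ≤ B p)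
    (hBz : ∀ p, ∀ u ∈ Dir, ‖Cov p *ᵥ u‖ ≤ B p) (hcV : ∀ m, |c m| ≤ cV m)
    (hobs : ∀ j, ∀ w ∈ obs j, w ∈ Dir) (hlegs : ∀ m, ∀ w ∈ legs m, w ∈ Dir) (K : Finset κ) (hW1 : 1 ≤ W)
    (hW : (∑ p, B p * Real.exp (a * (reg p).card))
      * ((∑ j ∈ K, ((obs j).length + 1 + M * maxArity legs) + ∑ m, (legs m).length : ℕ) : ℝ) ≤ W) :
    ((expand Cov trig f c legs obs M 0 K).map fun t => |t.coef| * (t.dirs.map fun z => ‖z‖).prod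
        * ((t.consts + t.groups).map fun X => Real.exp (a * ((X.pcs.map fun p => ((reg p).card : ℝ)).sum))).prod).sum
      ≤ W ^ ∑ j ∈ K, ((obs j).length + 1 + M * maxArity legs) := by
  -- the weighted brackets `B' p = B p · e^{a #reg p}` also bound the brackets (e^{a #reg} ≥ 1 is not needed: we bound
  -- the weight `wt B` and multiply by the exponential weights afterwards)
  set ρ : P → ℝ := fun p => B p * Real.exp (a * (reg p).card) with hρ
  have hρ0 : ∀ p, 0 ≤ ρ p := fun p => mul_nonneg (hB0 p) (Real.exp_nonneg _)
  refine le_trans (Multiset.sum_map_le_sum_map _ _ fun t ht => ?_) (expand_wsum_init_le (ρ := ρ) hρ0 K hW1 hW)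
  -- per term: `|coef|·Π‖dirs‖ ≤ Π wt` (the weight invariant) and `wt X · e^{a Σ #reg} ≤ pw ρ X`
  have hw := expand_weight_init (trig := trig) (M := M) hB0 hcV0 hB hBf hBz hcV hobs hlegs K t ht
  have hX : ∀ X : WGrp S κ ι P,
      wt B cV X * Real.exp (a * ((X.pcs.map fun p => ((reg p).card : ℝ)).sum)) ≤ pw ρ X := fun X => by
    have h1 := wt_le_pw hB0 hcV0 hcV1 X
    have e : pw ρ X = pw B X * Real.exp (a * ((X.pcs.map fun p => ((reg p).card : ℝ)).sum)) := by
      simp only [pw, hρ]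
      rw [Multiset.prod_map_mul, prod_map_exp, Multiset.sum_map_mul_left]
    rw [e]
    exact mul_le_mul_of_nonneg_right h1 (Real.exp_nonneg _)
  have hwt0 : ∀ X : WGrp S κ ι P, 0 ≤ wt B cV X := fun X =>
    mul_nonneg (Multiset.prod_nonneg fun x hx => by obtain ⟨p, -, rfl⟩ := Multiset.mem_map.1 hx; exact hB0 p)
      (Multiset.prod_nonneg fun x hx => by obtain ⟨m, -, rfl⟩ := Multiset.mem_map.1 hx; exact hcV0 m)
  have hexp0 : 0 ≤ ((t.consts + t.groups).map fun X =>
      Real.exp (a * ((X.pcs.map fun p => ((reg p).card : ℝ)).sum))).prod :=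
    Multiset.prod_nonneg fun x hx => by obtain ⟨X, -, rfl⟩ := Multiset.mem_map.1 hx; exact Real.exp_nonneg _
  calc |t.coef| * (t.dirs.map fun z => ‖z‖).prod
        * ((t.consts + t.groups).map fun X => Real.exp (a * ((X.pcs.map fun p => ((reg p).card : ℝ)).sum))).prod
      ≤ ((t.consts.map (wt B cV)).prod * (t.groups.map (wt B cV)).prod)
        * ((t.consts + t.groups).map fun X => Real.exp (a * ((X.pcs.map fun p => ((reg p).card : ℝ)).sum))).prod :=
        mul_le_mul_of_nonneg_right hw hexp0
    _ = ((t.consts + t.groups).map fun X =>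
          wt B cV X * Real.exp (a * ((X.pcs.map fun p => ((reg p).card : ℝ)).sum))).prod := by
        simp only [Multiset.prod_map_mul, Multiset.map_add, Multiset.prod_add]; ring
    _ ≤ ((t.consts + t.groups).map (pw ρ)).prod :=
        Multiset.prod_map_le_prod_map₀ _ _ (fun X _ => mul_nonneg (hwt0 X) (Real.exp_nonneg _)) fun X _ => hX X

end L1

end Literature.MathematicalPhysics.QuantumFieldTheory.BalabanImbrieJaffe1984to88.BIJ88WalkTermCount312

end
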